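import Summits.BirchSwinnertonDyer.BirchSwinnertonDyer.Theorems.Rank2ObservatoryCubicFieldM23
import HarnessLib

/-!
# BirchSwinnertonDyer — rank ≥ 2 observatory: further prime generators in the cubic field of discriminant `−23`

HONEST FRAMING: per-curve certified theorems and census instruments; no claim on BSD in rank ≥ 2.

Addendum to the per-field file `Rank2ObservatoryCubicFieldM23` (KERNEL-2DESC, design
`b2b-bsdr2-cert-3/KERNEL-2DESC.md` §4 B): generators of the primes of residue degree `2` above
`43, 53, 61, 79` in `K = ℚ(α)`, `α³ = α + 1` — the primes dividing `F′(θ)` for the census curves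
`3956c1` (`43`), `4876c1` (`53`), `5612a1` (`61`), `7268a1` (`79`) — each certified prime by the
residue certificate (`prime_of_natAbs_norm_eq_prime_pow`: norm `±p²` and `gₚ(t) ≠ 0` at every root
`t` of `X³ − X − 1 mod p`), with norm, real sign on the isolating interval of `ρ(α)`, and
distinctness from `g23`. Data: kit job `j124700` (`pilot.json`), re-verified in exact arithmetic.

Sorry-free; axioms `propext`, `Classical.choice`, `Quot.sound`. [cite: Marcus2018, Ch. 3, Thm. 22, 27]
-/

-- single-conjunct summit: `Summit.BirchSwinnertonDyer.BirchSwinnertonDyer.…` repeats the name by design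
set_option linter.dupNamespace false

noncomputable section

open scoped Classical NumberField

open Literature.NumberTheory.NumberFields Polynomial Module NumberField

namespace Summit.BirchSwinnertonDyer.BirchSwinnertonDyer.Rank2Observatory.TwoDescCubic

namespace FieldM23

/-- `K = ℚ(α)`. -/
local notation "K" => CubicField 0 (-1) (-1)

/-- `α`. -/
local notation "α" => CubicField.root 0 (-1) (-1)

/-- `α ∈ 𝓞 K`. -/
local notation "αi" => MonicCubic.thetaInt aeval_α

/-! ## The prime of degree `2` above `43` -/

/-- `g43 = 9 - 3 * α + 4 * α ^ 2`, a generator of the prime of residue degree `2` above `43`.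
[folklore] -/
def g43 : 𝓞 K := 9 - 3 * αi + 4 * αi ^ 2

/-- `g43` in `K`. [folklore] -/
theorem g43_coe : ((g43 : 𝓞 K) : K) = 9 - 3 * (α : K) + 4 * (α : K) ^ 2 := by
  simp only [g43, map_add, map_sub, map_mul, map_pow, map_ofNat,
    MonicCubic.coe_thetaInt]

/-- `N(g43) = 1849`. [folklore] -/
theorem g43_norm : Algebra.norm ℚ ((g43 : 𝓞 K) : K) = ((1849 : ℤ) : ℚ) := by
  rw [g43_coe, show (9 - 3 * (α : K) + 4 * (α : K) ^ 2 : K) =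
      ((9 : ℤ) : K) + ((-3 : ℤ) : K) * α + ((4 : ℤ) : K) * (α : K) ^ 2 by push_cast; ring, norm_lin']
  norm_num [MonicCubic.normForm]

/-- `g43` is prime (norm `±43²`, and `g43(t) ≠ 0` at every root `t` of `X³ − X − 1 mod 43`).
[cite: Marcus2018, Ch. 3, Thm. 22] -/
theorem g43_prime : Prime g43 := by
  refine prime_of_natAbs_norm_eq_prime_pow (p := 43) (k := 2) (by norm_num) (Or.inl rfl) ?_ ?_
  · rw [natAbs_norm_eq_of_norm_eq g43_norm]
    norm_num
  · intro ψ
    have h := ringHom_lin_ne_zero aeval_α ψ 9 (-3) (4) (by decide)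
    simpa [g43, sub_eq_add_neg] using h

/-- `g43 ≠ 0`. [folklore] -/
theorem g43_ne_zero : g43 ≠ 0 := g43_prime.ne_zero

/-- `g23 ≠ g43` (different norms). [folklore] -/
theorem g23_ne_g43 : g23 ≠ g43 := by
  intro h
  have h1 := g23_norm
  rw [h, g43_norm] at h1
  norm_num at h1

/-- Sign of `g43` at the real place. [folklore] -/
theorem g43_pos (ρ : K →+* ℝ) (hlo : ((331 / 250 : ℚ) : ℝ) < ρ α) (hhi : ρ α < ((53 / 40 : ℚ) : ℝ)) :
    0 < ρ ((g43 : 𝓞 K) : K) := by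
  have h := quad_pos_of_interval (by norm_num) hlo hhi 9 (-3) (4) (by norm_num [min_def, max_def])
  rw [g43_coe]
  simp only [map_add, map_sub, map_mul, map_pow, map_ofNat]
  push_cast at h
  linarith

/-! ## The prime of degree `2` above `53` -/

/-- `g53 = 17 + 6 * α - 7 * α ^ 2`, a generator of the prime of residue degree `2` above `53`.
[folklore] -/
def g53 : 𝓞 K := 17 + 6 * αi - 7 * αi ^ 2

/-- `g53` in `K`. [folklore] -/
theorem g53_coe : ((g53 : 𝓞 K) : K) = 17 + 6 * (α : K) - 7 * (α : K) ^ 2 := by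
  simp only [g53, map_add, map_sub, map_mul, map_pow, map_ofNat,
    MonicCubic.coe_thetaInt]

/-- `N(g53) = 2809`. [folklore] -/
theorem g53_norm : Algebra.norm ℚ ((g53 : 𝓞 K) : K) = ((2809 : ℤ) : ℚ) := by
  rw [g53_coe, show (17 + 6 * (α : K) - 7 * (α : K) ^ 2 : K) =
      ((17 : ℤ) : K) + ((6 : ℤ) : K) * α + ((-7 : ℤ) : K) * (α : K) ^ 2 by push_cast; ring, norm_lin']
  norm_num [MonicCubic.normForm]

/-- `g53` is prime (norm `±53²`, and `g53(t) ≠ 0` at every root `t` of `X³ − X − 1 mod 53`).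
[cite: Marcus2018, Ch. 3, Thm. 22] -/
theorem g53_prime : Prime g53 := by
  refine prime_of_natAbs_norm_eq_prime_pow (p := 53) (k := 2) (by norm_num) (Or.inl rfl) ?_ ?_
  · rw [natAbs_norm_eq_of_norm_eq g53_norm]
    norm_num
  · intro ψ
    have h := ringHom_lin_ne_zero aeval_α ψ 17 (6) (-7) (by decide)
    simpa [g53, sub_eq_add_neg] using h

/-- `g53 ≠ 0`. [folklore] -/
theorem g53_ne_zero : g53 ≠ 0 := g53_prime.ne_zero

/-- `g23 ≠ g53` (different norms). [folklore] -/
theorem g23_ne_g53 : g23 ≠ g53 := by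
  intro h
  have h1 := g23_norm
  rw [h, g53_norm] at h1
  norm_num at h1

/-- Sign of `g53` at the real place. [folklore] -/
theorem g53_pos (ρ : K →+* ℝ) (hlo : ((331 / 250 : ℚ) : ℝ) < ρ α) (hhi : ρ α < ((53 / 40 : ℚ) : ℝ)) :
    0 < ρ ((g53 : 𝓞 K) : K) := by
  have h := quad_pos_of_interval (by norm_num) hlo hhi 17 (6) (-7) (by norm_num [min_def, max_def])
  rw [g53_coe]
  simp only [map_add, map_sub, map_mul, map_pow, map_ofNat]
  push_cast at h
  linarith

/-! ## The prime of degree `2` above `61` -/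

/-- `g61 = -1 - 16 * α + 4 * α ^ 2`, a generator of the prime of residue degree `2` above `61`.
[folklore] -/
def g61 : 𝓞 K := -1 - 16 * αi + 4 * αi ^ 2

/-- `g61` in `K`. [folklore] -/
theorem g61_coe : ((g61 : 𝓞 K) : K) = -1 - 16 * (α : K) + 4 * (α : K) ^ 2 := by
  simp only [g61, map_add, map_sub, map_mul, map_pow, map_ofNat, map_one, map_neg,
    MonicCubic.coe_thetaInt]

/-- `N(g61) = -3721`. [folklore] -/
theorem g61_norm : Algebra.norm ℚ ((g61 : 𝓞 K) : K) = ((-3721 : ℤ) : ℚ) := by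
  rw [g61_coe, show (-1 - 16 * (α : K) + 4 * (α : K) ^ 2 : K) =
      ((-1 : ℤ) : K) + ((-16 : ℤ) : K) * α + ((4 : ℤ) : K) * (α : K) ^ 2 by push_cast; ring, norm_lin']
  norm_num [MonicCubic.normForm]

/-- `g61` is prime (norm `±61²`, and `g61(t) ≠ 0` at every root `t` of `X³ − X − 1 mod 61`).
[cite: Marcus2018, Ch. 3, Thm. 22] -/
theorem g61_prime : Prime g61 := by
  refine prime_of_natAbs_norm_eq_prime_pow (p := 61) (k := 2) (by norm_num) (Or.inl rfl) ?_ ?_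
  · rw [natAbs_norm_eq_of_norm_eq g61_norm]
    norm_num
  · intro ψ
    have h := ringHom_lin_ne_zero aeval_α ψ (-1) (-16) 4 (by decide)
    simpa [g61, sub_eq_add_neg] using h

/-- `g61 ≠ 0`. [folklore] -/
theorem g61_ne_zero : g61 ≠ 0 := g61_prime.ne_zero

/-- `g23 ≠ g61` (different norms). [folklore] -/
theorem g23_ne_g61 : g23 ≠ g61 := by
  intro h
  have h1 := g23_norm
  rw [h, g61_norm] at h1
  norm_num at h1

/-- Sign of `g61` at the real place. [folklore] -/
theorem g61_neg (ρ : K →+* ℝ) (hlo : ((331 / 250 : ℚ) : ℝ) < ρ α) (hhi : ρ α < ((53 / 40 : ℚ) : ℝ)) :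
    ρ ((g61 : 𝓞 K) : K) < 0 := by
  have h := quad_neg_of_interval (by norm_num) hlo hhi (-1) (-16) 4 (by norm_num [min_def, max_def])
  rw [g61_coe]
  simp only [map_add, map_sub, map_mul, map_pow, map_ofNat, map_one, map_neg]
  push_cast at h
  linarith

/-! ## The prime of degree `2` above `79` -/

/-- `g79 = 15 - 4 * α - 16 * α ^ 2`, a generator of the prime of residue degree `2` above `79`.
[folklore] -/
def g79 : 𝓞 K := 15 - 4 * αi - 16 * αi ^ 2

/-- `g79` in `K`. [folklore] -/
theorem g79_coe : ((g79 : 𝓞 K) : K) = 15 - 4 * (α : K) - 16 * (α : K) ^ 2 := by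
  simp only [g79, map_sub, map_mul, map_pow, map_ofNat,
    MonicCubic.coe_thetaInt]

/-- `N(g79) = -6241`. [folklore] -/
theorem g79_norm : Algebra.norm ℚ ((g79 : 𝓞 K) : K) = ((-6241 : ℤ) : ℚ) := by
  rw [g79_coe, show (15 - 4 * (α : K) - 16 * (α : K) ^ 2 : K) =
      ((15 : ℤ) : K) + ((-4 : ℤ) : K) * α + ((-16 : ℤ) : K) * (α : K) ^ 2 by push_cast; ring, norm_lin']
  norm_num [MonicCubic.normForm]

/-- `g79` is prime (norm `±79²`, and `g79(t) ≠ 0` at every root `t` of `X³ − X − 1 mod 79`).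
[cite: Marcus2018, Ch. 3, Thm. 22] -/
theorem g79_prime : Prime g79 := by
  refine prime_of_natAbs_norm_eq_prime_pow (p := 79) (k := 2) (by norm_num) (Or.inl rfl) ?_ ?_
  · rw [natAbs_norm_eq_of_norm_eq g79_norm]
    norm_num
  · intro ψ
    have h := ringHom_lin_ne_zero aeval_α ψ 15 (-4) (-16) (by decide)
    simpa [g79, sub_eq_add_neg] using h

/-- `g79 ≠ 0`. [folklore] -/
theorem g79_ne_zero : g79 ≠ 0 := g79_prime.ne_zero

/-- `g23 ≠ g79` (different norms). [folklore] -/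
theorem g23_ne_g79 : g23 ≠ g79 := by
  intro h
  have h1 := g23_norm
  rw [h, g79_norm] at h1
  norm_num at h1

/-- Sign of `g79` at the real place. [folklore] -/
theorem g79_neg (ρ : K →+* ℝ) (hlo : ((331 / 250 : ℚ) : ℝ) < ρ α) (hhi : ρ α < ((53 / 40 : ℚ) : ℝ)) :
    ρ ((g79 : 𝓞 K) : K) < 0 := by
  have h := quad_neg_of_interval (by norm_num) hlo hhi 15 (-4) (-16) (by norm_num [min_def, max_def])
  rw [g79_coe]
  simp only [map_sub, map_mul, map_pow, map_ofNat]
  push_cast at h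
  linarith

end FieldM23

end Summit.BirchSwinnertonDyer.BirchSwinnertonDyer.Rank2Observatory.TwoDescCubic

end
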